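import Summits.QuantumFields.YangMills.Theorems.DiagonalMirrorRPRWilsonDiagonalModelBlockSandwich
import Summits.QuantumFields.YangMills.Theorems.DiagonalMirrorRPRWilsonDiagonalModelGramPSD
import Summits.QuantumFields.YangMills.Theorems.DiagonalMirrorRPRWilsonDiagonalModelSpectralData
import Literature.Analysis.OperatorTheory.HermitianKernelSandwichedTrace

/-!
# Crux `WeakCouplingHypercubicLimitRP` (stmt-QuantumFields-27398) / aside `DiagonalMirrorRPR` (stmt-QuantumFields-10604), door B,
# construction F1_diag — PAIRING LAYER, step P3f/P4: the SPECTRAL SIDE `Σᵢ κᵢ^{n} ⟪bᵢ, 𝒲_f bᵢ⟫ = ∫ Θf · f · (K_u-chain of length n + 2d)`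

Helper file (`--supports stmt-QuantumFields-27398 --as helper`) of the hand `hand-10604-wilsonDiagModel-2` (docket director-ym O4 WORD 16 (1) /
28, steps P3/P4 of hand-1's ROADMAP-F1diag v4 §1⅞); it closes nothing by itself.

WHAT.  With hand-1's eigen-package of the reweighted lifted kernel `𝔟` on `L²(μ̃)` (`A bᵢ = κᵢ bᵢ`, `…SpectralData.exists_eigenPackage`) and the block
kernel operator `𝒲_f` of `…OpenLink` / `…GramPSD`:
* §1 `exists_blockKernelOp` — the bounded operator `𝒲_f` on `L²(μ̃)` with kernel `blockKernel f` (tree `exists_kernelOp`);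
* §2 ★★ **`hasSum_pow_mul_inner_blockKernelOp`** — for every `M′` and chain length `m = M′ + 2e + 4`:
  `Σᵢ κᵢ^{M′+2} ⟪bᵢ, 𝒲_f bᵢ⟫ = ∫ Θf(P) f(P) ∏_{t ∈ ℤ/mℤ} e^{β even_t} e^{β odd_t} dP`
  — the tree's one-insertion trace formula `PositiveKernelSpectralTrace.hasSum_integral_iterate_insert_one` (no sign condition on the
  eigenvalues) + the peeling `HermitianKernelSandwichedTrace.integral_cyclic_bond_insert_eq_integral_iterate_rclike` (at `𝕜 = ℝ`) + the sandwich form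
  `…BlockSandwich.integral_obsLR_mul_pairChain_eq_sandwich`;
* §3 `integral_obsLR_mul_pairChain_le` — **domination by the positive chain**: `∫ Θf f ∏ ≤ B² · diagCyclicTraceU ρ β m` when `|f| ≤ B` (P4 input);
  `abs_inner_basis_le_opNorm` — the Gram weights `⟪bᵢ, 𝒲_f bᵢ⟫` are bounded (non-negativity: `…GramPSD.inner_blockKernelOp_self_nonneg`).

HONEST FRAMING: the pairing layer at the operator level; `wilsonDiagonalModel` is NOT landed here (assembly next); no letter is proved; D1,
⟨27398⟩, S6i and the aside ⟨10604⟩ are OPEN; nothing here bears on the summit; the Yang–Mills mass gap is NOT proved here or anywhere in the tree.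
No definition, no instance, no notation, `autoImplicit false`.

References: K. Osterwalder, E. Seiler, Ann. Phys. 110 (1978) §2–3; B. Simon, *Trace Ideals* (2005) Ch. 3; M. Reed, B. Simon I (1980) §VI.6.
-/

set_option autoImplicit false

noncomputable section

open scoped BigOperators ENNReal RealInnerProductSpace
open MeasureTheory Function
open Literature.MathematicalPhysics.QuantumLattice Literature.MathematicalPhysics.QuantumFieldTheory
open Summit.QuantumFields.YangMills.Cruxes.DiagonalMirrorRPR.ParityBridgeColdTraces

namespace Summit.QuantumFields.YangMills.Cruxes.DiagonalMirrorRPR.SignTwistedDiagonalTrace.WilsonDiagonal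

section Spectral

variable {S : ℕ} [NeZero S] {G : Type} [Group G] {Nc : ℕ} (ρ : G →* Matrix (Fin Nc) (Fin Nc) ℂ)
variable [TopologicalSpace G] [IsTopologicalGroup G] [CompactSpace G] [MeasurableSpace G] [BorelSpace G]
  [SecondCountableTopology G]

/-! ## §1 The block kernel operator -/

/-- **The block kernel operator `𝒲_f`** on `L²(μ̃)`: a bounded operator with `(𝒲_f φ)(x) = ∫ blockKernel f (x, y) φ(y) dμ̃(y)` a.e. -/
theorem exists_blockKernelOp (hρ : Continuous ρ) {β : ℝ} (hβ : 0 ≤ β) {M : ℝ}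
    (hM : ∀ (Y : HalfCfg S S G) (j : Fin (featDim S Nc)), |bondVec ρ Y j| ≤ M) {e : ℕ}
    {f : (Fin (e + 1) → HalfCfg S S G) → (Fin (e + 1) → HalfCfg S S G) → ℝ} (hf : Measurable (uncurry f))
    {B : ℝ} (hB : ∀ Y X, |f Y X| ≤ B) :
    ∃ W : Lp ℝ 2 (tMeasure S G Nc β M) →L[ℝ] Lp ℝ 2 (tMeasure S G Nc β M),
      ∀ φ : Lp ℝ 2 (tMeasure S G Nc β M), (W φ : ℕ × HalfCfg S S G → ℝ) =ᵐ[tMeasure S G Nc β M]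
        fun x => ∫ y, blockKernel S G Nc ρ β M f x y * φ y ∂(tMeasure S G Nc β M) := by
  haveI := isFiniteMeasure_tMeasure (S := S) (G := G) (Nc := Nc) hβ M
  obtain ⟨CW, hCW⟩ := exists_abs_blockKernel_le (S := S) (Nc := Nc) ρ hρ hβ hM hB (e := e) (f := f)
  exact Literature.Analysis.OperatorTheory.exists_kernelOp (stronglyMeasurable_blockKernel (S := S) ρ hρ hβ M hf) hCW

/-! ## §2 ★★ The one-insertion trace formula for the block kernel -/

/-- ★★ **`Σᵢ κᵢ^{M′+2} ⟪bᵢ, 𝒲_f bᵢ⟫ = ∫ Θf · f · (K_u pair chain of length M′ + 2e + 4)`** (`β ≥ 0`, `ρ` continuous unitary, `|w(Y)_j| ≤ M`):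
for ANY bounded operator `A` on `L²(μ̃)` with kernel `𝔟` and countable Hilbert basis of eigenvectors `A bᵢ = κᵢ bᵢ`, any bounded measurable observable `f`
of depth `e + 1`, and any bounded operator `𝒲` with kernel `blockKernel f`. -/
theorem hasSum_pow_mul_inner_blockKernelOp (hρ : Continuous ρ) {β : ℝ} (hβ : 0 ≤ β)
    (hρu : ∀ g, ρ g ∈ Matrix.unitaryGroup (Fin Nc) ℂ) {M : ℝ}
    (hM : ∀ (Y : HalfCfg S S G) (j : Fin (featDim S Nc)), |bondVec ρ Y j| ≤ M)
    {A : Lp ℝ 2 (tMeasure S G Nc β M) →L[ℝ] Lp ℝ 2 (tMeasure S G Nc β M)}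
    (hA : ∀ φ : Lp ℝ 2 (tMeasure S G Nc β M), (A φ : ℕ × HalfCfg S S G → ℝ) =ᵐ[tMeasure S G Nc β M]
      fun x => ∫ y, bKernel ρ β M x y * φ y ∂(tMeasure S G Nc β M))
    {ι : Type} [Countable ι] {b : HilbertBasis ι ℝ (Lp ℝ 2 (tMeasure S G Nc β M))} {κ : ι → ℝ}
    (hb : ∀ i, A (b i) = κ i • b i) {e : ℕ}
    {f : (Fin (e + 1) → HalfCfg S S G) → (Fin (e + 1) → HalfCfg S S G) → ℝ} (hf : Measurable (uncurry f))
    {B : ℝ} (hB : ∀ Y X, |f Y X| ≤ B)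
    {W : Lp ℝ 2 (tMeasure S G Nc β M) →L[ℝ] Lp ℝ 2 (tMeasure S G Nc β M)}
    (hW : ∀ φ : Lp ℝ 2 (tMeasure S G Nc β M), (W φ : ℕ × HalfCfg S S G → ℝ) =ᵐ[tMeasure S G Nc β M]
      fun x => ∫ y, blockKernel S G Nc ρ β M f x y * φ y ∂(tMeasure S G Nc β M))
    (M' : ℕ) {m : ℕ} [NeZero m] (hm : m = M' + 2 * e + 4) :
    HasSum (fun i => κ i ^ (M' + 2) * ⟪b i, W (b i)⟫)
      (∫ P : ZMod m → HalfCfg S S G × HalfCfg S S G,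
        obsL f P * obsR f P * ∏ t : ZMod m, Real.exp (β * evenActionU ρ (P t).1 (P t).2 (P (t + 1)).1) *
          Real.exp (β * oddActionU ρ (P t).2 (P (t + 1)).1 (P (t + 1)).2)
        ∂(Measure.pi fun _ : ZMod m => (halfHaar S G).prod (halfHaar S G))) := by
  haveI := isFiniteMeasure_tMeasure (S := S) (G := G) (Nc := Nc) hβ M
  have hK := stronglyMeasurable_bKernel (S := S) ρ hρ β M
  obtain ⟨C, hC⟩ := exists_abs_bKernel_le ρ hρ β hM
  have hsymm := bKernel_symm (S := S) ρ β M
  have hX := stronglyMeasurable_blockKernel (S := S) (Nc := Nc) ρ hρ hβ M hf (e := e)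
  obtain ⟨CX, hCX⟩ := exists_abs_blockKernel_le (S := S) (Nc := Nc) ρ hρ hβ hM hB (e := e) (f := f)
  have h1 := Literature.Analysis.OperatorTheory.hasSum_integral_iterate_insert_one hK hC hsymm hA hb hX hCX hW M'
  rw [← Literature.Analysis.OperatorTheory.integral_cyclic_bond_insert_eq_integral_iterate_rclike (𝕜 := ℝ)
    hX.measurable hK.measurable hCX hC M'] at h1
  rw [integral_obsLR_mul_pairChain_eq_sandwich ρ hρ hβ hρu hM (n := M' + 2) (by omega) hf hB]
  exact h1

/-! ## §3 Domination by the positive chain; signs and bounds of the Gram weights -/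

/-- **Domination** (P4 input): `∫ Θf · f · ∏_t e^{β even_t} e^{β odd_t} dP ≤ B² · diagCyclicTraceU ρ β m` when `|f| ≤ B` (the chain weight is positive). -/
theorem integral_obsLR_mul_pairChain_le (hρ : Continuous ρ) (β : ℝ) {m : ℕ} [NeZero m] {e : ℕ}
    {f : (Fin (e + 1) → HalfCfg S S G) → (Fin (e + 1) → HalfCfg S S G) → ℝ} (hf : Measurable (uncurry f))
    {B : ℝ} (hB : ∀ Y X, |f Y X| ≤ B) :
    ∫ P : ZMod m → HalfCfg S S G × HalfCfg S S G,
        obsL f P * obsR f P * ∏ t : ZMod m, Real.exp (β * evenActionU ρ (P t).1 (P t).2 (P (t + 1)).1) *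
          Real.exp (β * oddActionU ρ (P t).2 (P (t + 1)).1 (P (t + 1)).2)
        ∂(Measure.pi fun _ : ZMod m => (halfHaar S G).prod (halfHaar S G)) ≤
      B ^ 2 * diagCyclicTraceU ρ β m (S := S) (G := G) := by
  haveI : IsProbabilityMeasure (halfHaar S G) := by unfold halfHaar; infer_instance
  rw [diagCyclicTraceU_eq_integral_pairs, ← integral_const_mul]
  have hB0 : 0 ≤ B := (abs_nonneg _).trans (hB (fun _ _ => 1) (fun _ _ => 1))
  -- the chain weight is continuous, non-negative and bounded
  set w : (ZMod m → HalfCfg S S G × HalfCfg S S G) → ℝ := fun P =>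
    ∏ t : ZMod m, Real.exp (β * evenActionU ρ (P t).1 (P t).2 (P (t + 1)).1) *
      Real.exp (β * oddActionU ρ (P t).2 (P (t + 1)).1 (P (t + 1)).2) with hw
  have hw0 : ∀ P, 0 ≤ w P := fun P => Finset.prod_nonneg fun t _ => (mul_pos (Real.exp_pos _) (Real.exp_pos _)).le
  -- the chain weight through the two-step kernel on glued layers: continuous, hence measurable and bounded
  have hglue : Continuous fun q : HalfCfg S S G × HalfCfg S S G => glue q.1 q.2 := by
    refine continuous_pi fun p => ?_
    unfold glue
    split_ifs
    · exact (continuous_apply _).comp continuous_fst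
    · exact (continuous_apply _).comp continuous_snd
  have hw_eq : w = fun P => ∏ t : ZMod m, stepKernelU ρ β (glue (P t).1 (P t).2) (glue (P (t + 1)).1 (P (t + 1)).2) := by
    funext P
    simp only [hw, stepKernelU_glue]
  have hpair : ∀ t : ZMod m, Continuous fun P : ZMod m → HalfCfg S S G × HalfCfg S S G =>
      (glue (P t).1 (P t).2, glue (P (t + 1)).1 (P (t + 1)).2) := fun t =>
    (hglue.comp (continuous_apply t)).prodMk (hglue.comp (continuous_apply (t + 1)))
  have hwc : Continuous w := by
    rw [hw_eq]
    refine continuous_finsetProd _ fun t _ => ?_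
    have h := (continuous_stepKernelU (S := S) ρ hρ β).comp (hpair t)
    simpa only [Function.comp_def, Function.uncurry] using h
  have hglue_m : Measurable fun q : HalfCfg S S G × HalfCfg S S G => glue q.1 q.2 := by
    refine measurable_pi_lambda _ fun p => ?_
    unfold glue
    split_ifs
    · exact (measurable_pi_apply _).comp measurable_fst
    · exact (measurable_pi_apply _).comp measurable_snd
  have hpair_m : ∀ t : ZMod m, Measurable fun P : ZMod m → HalfCfg S S G × HalfCfg S S G =>
      (glue (P t).1 (P t).2, glue (P (t + 1)).1 (P (t + 1)).2) := fun t =>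
    (hglue_m.comp (measurable_pi_apply t)).prodMk (hglue_m.comp (measurable_pi_apply (t + 1)))
  have hwm : Measurable w := by
    rw [hw_eq]
    refine Finset.measurable_prod _ fun t _ => ?_
    have h := (stronglyMeasurable_stepKernelU (S := S) ρ hρ β).measurable.comp (hpair_m t)
    simpa only [Function.comp_def, Function.uncurry] using h
  obtain ⟨Cw, hCw⟩ := (isCompact_univ.image hwc).isBounded.bddAbove
  have hwb : ∀ P, |w P| ≤ Cw := fun P => by
    rw [abs_of_nonneg (hw0 P)]; exact hCw ⟨P, Set.mem_univ _, rfl⟩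
  -- the observable is measurable and bounded by `B²`
  have hΩm : Measurable fun P : ZMod m → HalfCfg S S G × HalfCfg S S G => obsL f P * obsR f P := by
    refine Measurable.mul ?_ ?_
    · unfold obsL
      exact hf.comp ((measurable_pi_lambda _ fun i => (continuous_thetaHalf.measurable.comp
        (measurable_fst.comp (measurable_pi_apply _)))).prodMk
        (measurable_pi_lambda _ fun i => measurable_snd.comp (measurable_pi_apply _)))
    · unfold obsR
      exact hf.comp ((measurable_pi_lambda _ fun i => measurable_fst.comp (measurable_pi_apply _)).prodMk
        (measurable_pi_lambda _ fun i => measurable_snd.comp (measurable_pi_apply _)))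
  have hΩb : ∀ P : ZMod m → HalfCfg S S G × HalfCfg S S G, obsL f P * obsR f P ≤ B ^ 2 := fun P => by
    refine (le_abs_self _).trans ?_
    rw [abs_mul, sq]
    exact mul_le_mul (hB _ _) (hB _ _) (abs_nonneg _) hB0
  have hint1 : Integrable (fun P : ZMod m → HalfCfg S S G × HalfCfg S S G => obsL f P * obsR f P * w P)
      (Measure.pi fun _ : ZMod m => (halfHaar S G).prod (halfHaar S G)) := by
    refine Integrable.of_bound (hΩm.mul hwm).aestronglyMeasurable (B ^ 2 * Cw) (ae_of_all _ fun P => ?_)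
    rw [Real.norm_eq_abs, abs_mul, abs_mul, abs_of_nonneg (hw0 P), sq]
    exact mul_le_mul (mul_le_mul (hB _ _) (hB _ _) (abs_nonneg _) hB0) (hCw ⟨P, Set.mem_univ _, rfl⟩) (hw0 P)
      (by positivity)
  have hint2 : Integrable (fun P : ZMod m → HalfCfg S S G × HalfCfg S S G => B ^ 2 * w P)
      (Measure.pi fun _ : ZMod m => (halfHaar S G).prod (halfHaar S G)) := by
    refine Integrable.of_bound (hwm.const_mul _).aestronglyMeasurable (B ^ 2 * Cw) (ae_of_all _ fun P => ?_)
    rw [Real.norm_eq_abs, abs_mul, abs_of_nonneg (hw0 P), abs_of_nonneg (by positivity : (0 : ℝ) ≤ B ^ 2)]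
    exact mul_le_mul_of_nonneg_left (hCw ⟨P, Set.mem_univ _, rfl⟩) (by positivity)
  refine integral_mono hint1 hint2 fun P => ?_
  exact mul_le_mul_of_nonneg_right (hΩb P) (hw0 P)

end Spectral

section Generic

/-- The Gram weights are bounded: `|⟪bᵢ, 𝒲 bᵢ⟫| ≤ ‖𝒲‖` for a Hilbert basis of a real Hilbert space. -/
theorem abs_inner_basis_le_opNorm {E : Type*} [NormedAddCommGroup E] [InnerProductSpace ℝ E] [CompleteSpace E]
    {ι : Type*} (b : HilbertBasis ι ℝ E) (W : E →L[ℝ] E) (i : ι) : |⟪b i, W (b i)⟫| ≤ ‖W‖ := by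
  have h1 : ‖b i‖ = 1 := b.orthonormal.1 i
  calc |⟪b i, W (b i)⟫| ≤ ‖b i‖ * ‖W (b i)‖ := abs_real_inner_le_norm _ _
    _ ≤ ‖b i‖ * (‖W‖ * ‖b i‖) := mul_le_mul_of_nonneg_left (W.le_opNorm _) (norm_nonneg _)
    _ = ‖W‖ := by rw [h1, one_mul, mul_one]

end Generic

end Summit.QuantumFields.YangMills.Cruxes.DiagonalMirrorRPR.SignTwistedDiagonalTrace.WilsonDiagonal

end
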